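import Literature.MathematicalPhysics.QuantumFieldTheory.QCDPhaseQuenchedMomentUpgrade
import Literature.MathematicalPhysics.QuantumFieldTheory.QCDHeavyQuarkPropagator

/-!
# The integrability conjunct of `GramMoments` at `r = 1`
(crux stmt-QuantumFields-9151 `PauliWegnerSea.PhaseQuenchedFlavourDecay`, line `crossing-split-integrability`, lead c4 —
registered additive stub `stub_gramMomentIntegrableR1Of`)

From the finite phase-quenched `(1+ε)`-moments of propagator entries (registered stub `stub_entryMomentIntegrable`,
here a hypothesis) the `q`-th power, `1/2 < q < (1+s₀)/2`, `q ≤ 1`, of the `1 × 1` Gram minor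
`Re det((G Gᴴ)[I,I]) = Σ_l ‖G(I 0, l)‖²` — the `r = 1` integrand of the open core `stub_gramMomentsCore` verbatim — is
integrable under `qcdLatticeMeasure`, on every torus of side `≥ 4`, for every `β` and mass vector: subadditivity of
`x ↦ x^q` (`q ≤ 1`) and vanishing of the off-flavour entries.  Only integrability; the uniform bound is the open core.
-/

noncomputable section

namespace Summit.QuantumFields.QCD.Cruxes.PhaseQuenchedFlavourDecay.CrossingSplitIntegrability

open scoped BigOperators ENNReal ComplexConjugate
open MeasureTheory Filter Set Matrix
open Literature.MathematicalPhysics.QuantumFieldTheory Literature.MathematicalPhysics.QuantumLattice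
  Literature.Probability.LatticeModels

section GramR1

variable
  (hE : ∃ s₀ : ℝ, 0 < s₀ ∧ ∀ ε : ℝ, 0 < ε → ε < s₀ → ∀ (Nf L : ℕ) [NeZero L], 4 ≤ L →
      ∀ (β : ℝ) (mq : Fin Nf → ℝ) (f : Fin Nf) (p q : TorusSite 4 L × Fin 3 × Fin 4),
        MeasureTheory.Integrable (fun U : GaugeConfig 4 L SU3 =>
          ‖(diracMatrix U mq)⁻¹ (quarkEquiv (f, p)) (quarkEquiv (f, q))‖ ^ (1 + ε)) (qcdLatticeMeasure L β mq))

variable {Nf L : ℕ} [NeZero L]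

/-- Finite subadditivity of `x ↦ x^q` for `0 < q ≤ 1` on non-negative reals: `(Σ_i f i)^q ≤ Σ_i (f i)^q`. -/
theorem rpow_sum_le_sum_rpow_of_le_one {ι' : Type*} (s : Finset ι') (f : ι' → ℝ)
    (hf : ∀ i ∈ s, 0 ≤ f i) {q : ℝ} (hq0 : 0 < q) (hq1 : q ≤ 1) :
    (∑ i ∈ s, f i) ^ q ≤ ∑ i ∈ s, f i ^ q := by
  classical
  induction s using Finset.induction_on with
  | empty => simp [Real.zero_rpow hq0.ne']
  | @insert a s ha ih =>
    rw [Finset.sum_insert ha, Finset.sum_insert ha]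
    have ha0 : 0 ≤ f a := hf a (Finset.mem_insert_self a s)
    have hs0 : ∀ i ∈ s, 0 ≤ f i := fun i hi => hf i (Finset.mem_insert_of_mem hi)
    exact (Real.rpow_add_le_add_rpow ha0 (Finset.sum_nonneg hs0) hq0.le hq1).trans
      (add_le_add le_rfl (ih hs0))

/-- The diagonal of the inverse fermion Gram matrix is the squared row norm: `Re (G Gᴴ)(i,i) = Σ_l ‖G(i,l)‖²`. -/
theorem re_mul_conjTranspose_apply_self (G : Matrix (FermiIdx Nf L) (FermiIdx Nf L) ℂ) (i : FermiIdx Nf L) :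
    ((G * Gᴴ) i i).re = ∑ l, ‖G i l‖ ^ 2 := by
  rw [Matrix.mul_apply, Complex.re_sum]
  refine Finset.sum_congr rfl fun l _ => ?_
  rw [conjTranspose_apply, Complex.star_def, Complex.mul_conj, Complex.normSq_eq_norm_sq]
  norm_cast

/-- Off-flavour entries of `(diracMatrix U mq)⁻¹` vanish identically (flavour-block-diagonal inverse off the singular
set, Mathlib's junk `0` on it). -/
theorem inv_diracMatrix_apply_of_ne' (U : GaugeConfig 4 L SU3) (mq : Fin Nf → ℝ) {f g : Fin Nf} (hfg : f ≠ g)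
    (p q : QuarkIdx L) : (diracMatrix U mq)⁻¹ (quarkEquiv (f, p)) (quarkEquiv (g, q)) = 0 := by
  by_cases hall : ∀ g', (wilsonDirac (fundamentalRep (Fin 3)) U (mq g') 1).det ≠ 0
  · exact inv_diracMatrix_apply_of_ne U mq hall hfg p q
  · push Not at hall
    obtain ⟨g', hg'⟩ := hall
    have h0 : (diracMatrix U mq).det = 0 := by
      rw [det_diracMatrix]
      exact Finset.prod_eq_zero (Finset.mem_univ g') hg'
    rw [Matrix.nonsing_inv_apply_not_isUnit _ (by rw [h0]; exact not_isUnit_zero), Matrix.zero_apply]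

include hE in
omit [NeZero L] in
/-- **Integrability conjunct of `GramMoments` at `r = 1`**: for `1/2 < q < (1 + s₀)/2`, every `N_f`, torus of side
`L ≥ 4`, `β`, mass vector and row `I : Fin 1 → QuarkVar`, the `q`-th power of the `1 × 1` Gram minor
`Re det((G Gᴴ)[I,I]) = Σ_l ‖G(I 0, l)‖²` is integrable under `qcdLatticeMeasure` (subadditivity of `x ↦ x^q`, `q ≤ 1`,
and the entry moments at exponent `2q = 1 + ε`; off-flavour entries vanish identically). -/
theorem gramMomentIntegrable_r1_of :
    ∃ s₀ : ℝ, 0 < s₀ ∧ ∀ q : ℝ, 1 / 2 < q → q < (1 + s₀) / 2 → q ≤ 1 → ∀ (Nf L : ℕ) [NeZero L], 4 ≤ L →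
      ∀ (β : ℝ) (mq : Fin Nf → ℝ) (I : Fin 1 → QuarkVar Nf L),
        Integrable (fun U : GaugeConfig 4 L SU3 =>
          (Matrix.of fun a b : Fin 1 =>
            ((diracMatrix U mq)⁻¹ * ((diracMatrix U mq)⁻¹).conjTranspose)
              (quarkEquiv (I a)) (quarkEquiv (I b))).det.re ^ q) (qcdLatticeMeasure L β mq) := by
  obtain ⟨s₀, hs₀, hent⟩ := hE
  refine ⟨s₀, hs₀, fun q hq hqs hq1 Nf L _ hL β mq I => ?_⟩
  have hq0 : 0 < q := by linarith
  set ε : ℝ := 2 * q - 1 with hεdef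
  have hε : 0 < ε := by rw [hεdef]; linarith
  have hεs : ε < s₀ := by rw [hεdef]; linarith
  have h2q : 2 * q = 1 + ε := by rw [hεdef]; ring
  set i : FermiIdx Nf L := quarkEquiv (I 0) with hi
  -- the integrand is `(Σ_l ‖G i l‖²)^q`
  have hfun : (fun U : GaugeConfig 4 L SU3 =>
      (Matrix.of fun a b : Fin 1 =>
        ((diracMatrix U mq)⁻¹ * ((diracMatrix U mq)⁻¹).conjTranspose) (quarkEquiv (I a)) (quarkEquiv (I b))).det.re ^ q)
      = fun U => (∑ l, ‖(diracMatrix U mq)⁻¹ i l‖ ^ 2) ^ q := by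
    funext U
    rw [Matrix.det_fin_one, Matrix.of_apply, re_mul_conjTranspose_apply_self]
  rw [hfun]
  -- each term `‖G i l‖^{2q}` is integrable
  have hterm : ∀ l : FermiIdx Nf L,
      Integrable (fun U : GaugeConfig 4 L SU3 => ‖(diracMatrix U mq)⁻¹ i l‖ ^ (2 * q)) (qcdLatticeMeasure L β mq) := by
    intro l
    obtain ⟨⟨g, r'⟩, rfl⟩ := quarkEquiv.surjective l
    rcases hI0 : I 0 with ⟨f, p⟩
    have hi' : i = quarkEquiv (f, p) := by rw [hi, hI0]
    by_cases hfg : f = g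
    · subst hfg
      rw [hi', h2q]
      exact hent ε hε hεs Nf L hL β mq f p r'
    · have : (fun U : GaugeConfig 4 L SU3 => ‖(diracMatrix U mq)⁻¹ i (quarkEquiv (g, r'))‖ ^ (2 * q)) = fun _ => 0 := by
        funext U
        rw [hi', inv_diracMatrix_apply_of_ne' U mq hfg p r', norm_zero, Real.zero_rpow (by linarith)]
      rw [this]
      exact integrable_zero _ _ _
  have hsum : Integrable (fun U : GaugeConfig 4 L SU3 => ∑ l, ‖(diracMatrix U mq)⁻¹ i l‖ ^ (2 * q))
      (qcdLatticeMeasure L β mq) := integrable_finsetSum _ fun l _ => hterm l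
  -- measurability of the entry norms (determinant inverse times adjugate entry; cf. the entry-moment file)
  have hmeasEntry : ∀ l : FermiIdx Nf L, Measurable fun U : GaugeConfig 4 L SU3 => ‖(diracMatrix U mq)⁻¹ i l‖ := by
    intro l
    have hadj : Continuous fun U : GaugeConfig 4 L SU3 => (diracMatrix U mq).adjugate i l :=
      ((continuous_diracMatrix (S := L) mq).matrix_adjugate).matrix_elem i l
    have h1 : (fun U : GaugeConfig 4 L SU3 => (diracMatrix U mq)⁻¹ i l) =
        fun U => ((diracMatrix U mq).det)⁻¹ * (diracMatrix U mq).adjugate i l := by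
      funext U; rw [Matrix.inv_def, Matrix.smul_apply, smul_eq_mul, Ring.inverse_eq_inv']
    have h2 : Measurable fun U : GaugeConfig 4 L SU3 => (diracMatrix U mq)⁻¹ i l := by
      rw [h1]
      exact ((continuous_det_diracMatrix (S := L) mq).measurable.inv).mul hadj.measurable
    exact h2.norm
  have hmeas : AEStronglyMeasurable (fun U : GaugeConfig 4 L SU3 => (∑ l, ‖(diracMatrix U mq)⁻¹ i l‖ ^ 2) ^ q)
      (qcdLatticeMeasure L β mq) :=
    ((Finset.measurable_sum _ fun l _ => (hmeasEntry l).pow_const _).pow_const _).aestronglyMeasurable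
  refine hsum.mono' hmeas (Eventually.of_forall fun U => ?_)
  have h0 : ∀ l, 0 ≤ ‖(diracMatrix U mq)⁻¹ i l‖ ^ 2 := fun l => by positivity
  rw [Real.norm_eq_abs, abs_of_nonneg (Real.rpow_nonneg (Finset.sum_nonneg fun l _ => h0 l) _)]
  refine (rpow_sum_le_sum_rpow_of_le_one _ _ (fun l _ => h0 l) hq0 hq1).trans (le_of_eq ?_)
  refine Finset.sum_congr rfl fun l _ => ?_
  rw [← Real.rpow_natCast, ← Real.rpow_mul (norm_nonneg _)]
  norm_num

end GramR1

/-- **stub `stub_gramMomentIntegrableR1Of` (registered additive stub of crux stmt-QuantumFields-9151)** — the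
integrability conjunct of `GramMoments` at `r = 1`, modulo the entry-moment statement (`stub_entryMomentIntegrable`). -/
theorem stub_gramMomentIntegrableR1Of :
    (∃ s₀ : ℝ, 0 < s₀ ∧ ∀ ε : ℝ, 0 < ε → ε < s₀ → ∀ (Nf L : ℕ) [NeZero L], 4 ≤ L →
      ∀ (β : ℝ) (mq : Fin Nf → ℝ) (f : Fin Nf) (p q : TorusSite 4 L × Fin 3 × Fin 4),
        MeasureTheory.Integrable (fun U : GaugeConfig 4 L SU3 =>
          ‖(diracMatrix U mq)⁻¹ (quarkEquiv (f, p)) (quarkEquiv (f, q))‖ ^ (1 + ε)) (qcdLatticeMeasure L β mq)) →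
    ∃ s₀ : ℝ, 0 < s₀ ∧ ∀ q : ℝ, 1 / 2 < q → q < (1 + s₀) / 2 → q ≤ 1 → ∀ (Nf L : ℕ) [NeZero L], 4 ≤ L →
      ∀ (β : ℝ) (mq : Fin Nf → ℝ) (I : Fin 1 → QuarkVar Nf L),
        MeasureTheory.Integrable (fun U : GaugeConfig 4 L SU3 =>
          (Matrix.of fun a b : Fin 1 =>
            ((diracMatrix U mq)⁻¹ * ((diracMatrix U mq)⁻¹).conjTranspose)
              (quarkEquiv (I a)) (quarkEquiv (I b))).det.re ^ q) (qcdLatticeMeasure L β mq) :=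
  fun hE => gramMomentIntegrable_r1_of hE


end Summit.QuantumFields.QCD.Cruxes.PhaseQuenchedFlavourDecay.CrossingSplitIntegrability

end
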